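import Literature.Geometry.Kaehler.ComplexTorusLefschetzLieAlgebraRatSemisimpleIsogenyFactors
import Literature.Geometry.Kaehler.ComplexTorusEndomorphismAlgebraCenterSigmaPi
import Literature.Geometry.Kaehler.ComplexTorusSimpleIsogenyInvariant
import HarnessLib

/-!
# The centre of `End_ℚ(X)` of a SIMPLE complex torus along an isogeny: `Z(End_ℚ(X₁)) ≃+* Z(End_ℚ(X₂))`, same degree
# `e`, same index `[End_ℚ : Z]`, «totally real» and «CM» are isogeny invariants — and with them the «Semisimple» column
# and the row «IV» of Milne's table

Layer `Literature/Geometry/Kaehler`, namespace `Literature.Geometry.Kaehler.ComplexTorus`; lane `lit-hodgefound` (Track 2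
foundations library); prover seat `lit-hodgefound-p17`, generation 60, self-proposed row g60-#4 — riders making the invariants
read by ✔ g60-#1 ∕ #2 ∕ #3 (`centerField`, its degree, `IsTotallyReal ∕ IsCMField`, `finrank (centerField) (endAlgRat)`,
`LieAlgebra.IsSemisimple ℚ (Lie S(X))`, `IsAlbertTypeIV`) ISOGENY INVARIANTS of simple tori, so that the factor-level statements of
✔ g60-#3 do not depend on the representatives `B_k` chosen in `X ∼ ∏ B_k^{n_k}` («Any such isogeny induces an isomorphism …
which is independent of the choice of the isogeny»).  Everything BY NAME from the tree: `IsIsogenous.nonempty_algEquiv_center_endAlgRat`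
(p36: `Z(End_ℚ(X₁)) ≃ₐ[ℚ] Z(End_ℚ(X₂))` from `IsIsogenous.nonempty_endAlgRatEquiv`, Lange Cor. 2.4.26), `IsIsogenous.isSimple_iff`,
`IsIsogenous.nonempty_lefschetzLieRat_lieEquiv` (g18-#3), Mathlib's `isTotallyReal_iff_ofRingEquiv`.  THEOREMS ONLY (no definition,
no instance, no notation, no named fact; D-0026 net debt `0`).

## Sources, VERBATIM

* H. Lange [Lange2023AbelianVarietiesComplex], *Abelian Varieties over the Complex Numbers* (2023), §2.4.4 Cor. 2.4.26 and its proof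
  (p. 124: an isogeny `f` induces `End_ℚ(X) → End_ℚ(Y)`, `φ ↦ f φ f⁻¹`, an isomorphism of `ℚ`-algebras); §2.6.1 (p. 137: «Let `K`
  denote the centre of `F` … `[F : K] = d²`, `[K : ℚ] = e`»).
* D. Mumford [MumfordAV1970], *Abelian Varieties*, §19 Cor. 1–2 of Thm. 1 (`End⁰(X)` depends only on the isogeny class).
* J. S. Milne [Milne1999LefschetzClasses], §1 Prop. 1.1 ∕ Prop. 1.5 (p. 643–644: «Any such isogeny induces an isomorphism
  `S(A₁) × ⋯ × S(A_s) → S(A)`, which is independent of the choice of the isogeny») and §2 Summary table p. 652.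

## What is proved (`X₁ ∼ X₂` complex tori, `X₁` — hence `X₂` — simple; `Kᵢ = centerField Φᵢ hXᵢ`)

* §1 **`IsIsogenous.nonempty_centerField_ringEquiv`** (`K₁ ≃+* K₂`), `IsIsogenous.finrank_centerField_eq` (`e₁ = e₂`),
  **`IsIsogenous.finrank_centerField_endAlgRat_eq`** (`[End_ℚ(X₁) : K₁] = [End_ℚ(X₂) : K₂]`, i.e. `d₁ = d₂`),
  **`IsIsogenous.isTotallyReal_centerField_iff`**, `IsIsogenous.isCMField_centerField_iff` (polarised).
* §2 the table's Boolean invariants: **`IsIsogenous.isSemisimple_lefschetzLieRat_iff`** (`Lie S(X₁)` semisimple ⟺ `Lie S(X₂)`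
  semisimple — any complex tori, any polarisations), `IsIsogenous.center_lefschetzLieRat_eq_bot_iff`, and for simple tori
  **`IsIsogenous.isAlbertTypeIV_iff`** (row IV is an isogeny invariant).

NOT here: transport of `IsAlbertTypeII` vs `III` (needs the quaternion algebra `End_ℚ(X₁) ≃ End_ℚ(X₂)` OVER the centre iso,
i.e. the ramification at infinity along `K₁ ≃ K₂`) — the pair {II, III} as a whole is invariant by §1 (`e`, `d`, totally real).
-/

noncomputable section

open scoped Matrix
open Module Matrix Complex Function NumberField
open Literature.RingTheory.CentralSimple (IsAlbertTypeIV)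

namespace Literature.Geometry.Kaehler

namespace ComplexTorus

/-! ## §1 The centre field along an isogeny -/

section Center

variable {ι₁ ι₂ : Type*} [Fintype ι₁] [Fintype ι₂] [DecidableEq ι₁] [DecidableEq ι₂] [Nonempty ι₁] [Nonempty ι₂]
  {E₁ E₂ : Type*} [NormedAddCommGroup E₁] [NormedSpace ℂ E₁] [NormedAddCommGroup E₂] [NormedSpace ℂ E₂]
  {Φ₁ : (ι₁ → ℝ) ≃L[ℝ] E₁} {Φ₂ : (ι₂ → ℝ) ≃L[ℝ] E₂}

/-- **`Z(End_ℚ(X₁)) ≃+* Z(End_ℚ(X₂))` FOR ISOGENOUS SIMPLE TORI** (the centre fields `centerField`; restriction of the tree's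
`End_ℚ(X₁) ≃ₐ[ℚ] End_ℚ(X₂)`, `φ ↦ f φ f⁻¹`). [cite: Lange2023AbelianVarietiesComplex, §2.4.4 Cor. 2.4.26 (proof, p. 124)]
[cite: MumfordAV1970, §19 Cor. 1 of Thm. 1] -/
theorem IsIsogenous.nonempty_centerField_ringEquiv (h : IsIsogenous Φ₁ Φ₂) (hX₁ : IsSimple Φ₁) (hX₂ : IsSimple Φ₂) :
    Nonempty (centerField Φ₁ hX₁ ≃+* centerField Φ₂ hX₂) := by
  obtain ⟨e⟩ := h.nonempty_algEquiv_center_endAlgRat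
  exact ⟨e.toRingEquiv⟩

/-- **`e₁ = e₂`**: isogenous simple tori have centres of the same degree `[K : ℚ]`. [cite: Lange2023AbelianVarietiesComplex, §2.4.4 Cor. 2.4.26 and §2.6.1 (p. 137: `[K : ℚ] = e`)] -/
theorem IsIsogenous.finrank_centerField_eq (h : IsIsogenous Φ₁ Φ₂) (hX₁ : IsSimple Φ₁) (hX₂ : IsSimple Φ₂) :
    finrank ℚ (centerField Φ₁ hX₁) = finrank ℚ (centerField Φ₂ hX₂) := by
  rw [ComplexTorus.finrank_centerField_eq, ComplexTorus.finrank_centerField_eq]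
  exact h.finrank_center_endAlgRat_eq

/-- `ℚ ⊆ K ⊆ End_ℚ(X)` is a scalar tower. [folklore] -/
private theorem isScalarTower_rat₆₀ {ι : Type*} [Fintype ι] [DecidableEq ι] [Nonempty ι] {E : Type*} [NormedAddCommGroup E]
    [NormedSpace ℂ E] {Ψ : (ι → ℝ) ≃L[ℝ] E} (hX : IsSimple Ψ) : IsScalarTower ℚ (centerField Ψ hX) (endAlgRat Ψ) :=
  IsScalarTower.of_algebraMap_smul fun q x ↦ by
    rw [Algebra.smul_def, Algebra.algebraMap_eq_smul_one q,
      map_rat_smul (algebraMap (centerField Ψ hX) (endAlgRat Ψ)) q 1, map_one, smul_mul_assoc, one_mul]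

/-- **`d₁ = d₂`: `[End_ℚ(X₁) : K₁] = [End_ℚ(X₂) : K₂]`** for isogenous simple tori (`[End_ℚ : ℚ] = e · [End_ℚ : K]` on both sides,
with `[End_ℚ(X₁) : ℚ] = [End_ℚ(X₂) : ℚ]` and `e₁ = e₂`). [cite: Lange2023AbelianVarietiesComplex, §2.4.4 Cor. 2.4.26 and §2.6.1 (p. 137: `[F : K] = d²`)] -/
theorem IsIsogenous.finrank_centerField_endAlgRat_eq (h : IsIsogenous Φ₁ Φ₂) (hX₁ : IsSimple Φ₁) (hX₂ : IsSimple Φ₂) :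
    finrank (centerField Φ₁ hX₁) (endAlgRat Φ₁) = finrank (centerField Φ₂ hX₂) (endAlgRat Φ₂) := by
  haveI := isScalarTower_rat₆₀ hX₁
  haveI := isScalarTower_rat₆₀ hX₂
  have h₁ := Module.finrank_mul_finrank ℚ (centerField Φ₁ hX₁) (endAlgRat Φ₁)
  have h₂ := Module.finrank_mul_finrank ℚ (centerField Φ₂ hX₂) (endAlgRat Φ₂)
  have hE : finrank ℚ (endAlgRat Φ₁) = finrank ℚ (endAlgRat Φ₂) := h.finrank_endAlgRat_eq
  have he : finrank ℚ (centerField Φ₁ hX₁) = finrank ℚ (centerField Φ₂ hX₂) := h.finrank_centerField_eq hX₁ hX₂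
  have hpos : 0 < finrank ℚ (centerField Φ₂ hX₂) := finrank_pos
  refine Nat.eq_of_mul_eq_mul_left hpos ?_
  rw [← he, h₁, hE, he, h₂]

/-- **«TOTALLY REAL CENTRE» IS AN ISOGENY INVARIANT** of simple tori (first kind, `K = K₀`). [cite: Lange2023AbelianVarietiesComplex, §2.4.4 Cor. 2.4.26 and §2.6.1 (p. 137)]
[cite: MumfordAV1970, §19 Cor. 1 of Thm. 1] -/
theorem IsIsogenous.isTotallyReal_centerField_iff (h : IsIsogenous Φ₁ Φ₂) (hX₁ : IsSimple Φ₁) (hX₂ : IsSimple Φ₂) :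
    IsTotallyReal (centerField Φ₁ hX₁) ↔ IsTotallyReal (centerField Φ₂ hX₂) := by
  obtain ⟨e⟩ := h.nonempty_centerField_ringEquiv hX₁ hX₂
  exact isTotallyReal_iff_ofRingEquiv e

/-- A CM field is not totally real. [folklore] -/
private theorem not_isTotallyReal_of_isCMField₆₀₄ (K : Type*) [Field K] [NumberField K] [IsCMField K] : ¬ IsTotallyReal K := by
  intro hK
  apply IsCMField.complexConj_ne_one K
  ext x
  rw [AlgEquiv.one_apply]
  exact (IsCMField.complexConj_eq_self_iff (K := K) x).2 (IsTotallyReal.maximalRealSubfield_eq_top (K := K) ▸ Subfield.mem_top x)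

/-- **«CM CENTRE» IS AN ISOGENY INVARIANT** of simple POLARISED tori (second kind; by Shimura's Prop. 5 each centre is totally real or
CM, never both). [cite: Lange2023AbelianVarietiesComplex, §2.4.4 Cor. 2.4.26, §2.6.2 Lemma 2.6.4 ∕ 2.6.6] [cite: Shimura1998, §5.1 Prop. 5 (p. 36)] -/
theorem IsIsogenous.isCMField_centerField_iff (h : IsIsogenous Φ₁ Φ₂) (hX₁ : IsSimple Φ₁) (hX₂ : IsSimple Φ₂)
    {η₁ : E₁ [⋀^Fin 2]→L[ℝ] ℝ} {η₂ : E₂ [⋀^Fin 2]→L[ℝ] ℝ} (hη₁ : IsRiemannForm Φ₁ η₁) (hη₂ : IsRiemannForm Φ₂ η₂) :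
    IsCMField (centerField Φ₁ hX₁) ↔ IsCMField (centerField Φ₂ hX₂) := by
  have hR := h.isTotallyReal_centerField_iff hX₁ hX₂
  constructor
  · intro h₁
    refine (hX₂.centerField_isTotallyReal_or_isCMField hη₂).resolve_left fun h₂ ↦ ?_
    exact not_isTotallyReal_of_isCMField₆₀₄ (centerField Φ₁ hX₁) (hR.2 h₂)
  · intro h₂
    refine (hX₁.centerField_isTotallyReal_or_isCMField hη₁).resolve_left fun h₁ ↦ ?_
    exact not_isTotallyReal_of_isCMField₆₀₄ (centerField Φ₂ hX₂) (hR.1 h₁)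

end Center

/-! ## §2 The Boolean columns of Milne's table along an isogeny -/

section Table

variable {ι₁ ι₂ : Type*} [Fintype ι₁] [Fintype ι₂] [DecidableEq ι₁] [DecidableEq ι₂]
  {E₁ E₂ : Type*} [NormedAddCommGroup E₁] [NormedSpace ℂ E₁] [NormedAddCommGroup E₂] [NormedSpace ℂ E₂]
  {Φ₁ : (ι₁ → ℝ) ≃L[ℝ] E₁} {Φ₂ : (ι₂ → ℝ) ≃L[ℝ] E₂} {η₁ : E₁ [⋀^Fin 2]→L[ℝ] ℝ} {η₂ : E₂ [⋀^Fin 2]→L[ℝ] ℝ}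
  {G₁ : Matrix ι₁ ι₁ ℚ} {G₂ : Matrix ι₂ ι₂ ℚ}

/-- **`𝔷(Lie S(X₁)) = 0 ⟺ 𝔷(Lie S(X₂)) = 0` for isogenous polarised tori** (along g18-#3's `Lie S(X₁) ≃ₗ⁅ℚ⁆ Lie S(X₂)`).
[cite: Milne1999LefschetzClasses, §1 Prop. 1.1 and Prop. 1.5 («independent of the choice of the isogeny»)] -/
theorem IsIsogenous.center_lefschetzLieRat_eq_bot_iff (h : IsIsogenous Φ₁ Φ₂) (hη₁ : IsRiemannForm Φ₁ η₁) (hη₂ : IsRiemannForm Φ₂ η₂)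
    (hG₁ : G₁.map (Rat.cast : ℚ → ℝ) = latticeGram Φ₁ η₁) (hG₂ : G₂.map (Rat.cast : ℚ → ℝ) = latticeGram Φ₂ η₂) :
    LieAlgebra.center ℚ ↥(lefschetzLieRat Φ₁ G₁) = ⊥ ↔ LieAlgebra.center ℚ ↥(lefschetzLieRat Φ₂ G₂) = ⊥ := by
  obtain ⟨e⟩ := h.nonempty_lefschetzLieRat_lieEquiv hη₁ hη₂ hG₁ hG₂
  exact center_eq_bot_iff_of_lieEquiv e

variable [FiniteDimensional ℂ E₁] [FiniteDimensional ℂ E₂]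

/-- **«SEMISIMPLE» IS AN ISOGENY INVARIANT: `Lie S(X₁)` semisimple over `ℚ` ⟺ `Lie S(X₂)` semisimple**, for isogenous polarised
complex tori (both are reductive; their `ℚ`-Lie algebras are isomorphic). [cite: Milne1999LefschetzClasses, §1 Prop. 1.1, Prop. 1.5 and p. 644 («a reductive group … over `k`»)]
[cite: Bourbaki1989LieGroups13, Ch. I §6 no. 4 Prop. 5] -/
theorem IsIsogenous.isSemisimple_lefschetzLieRat_iff (h : IsIsogenous Φ₁ Φ₂) (hη₁ : IsRiemannForm Φ₁ η₁) (hη₂ : IsRiemannForm Φ₂ η₂)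
    (hG₁ : G₁.map (Rat.cast : ℚ → ℝ) = latticeGram Φ₁ η₁) (hG₂ : G₂.map (Rat.cast : ℚ → ℝ) = latticeGram Φ₂ η₂) :
    LieAlgebra.IsSemisimple ℚ ↥(lefschetzLieRat Φ₁ G₁) ↔ LieAlgebra.IsSemisimple ℚ ↥(lefschetzLieRat Φ₂ G₂) := by
  rw [hη₁.isSemisimple_lefschetzLieRat_iff_center_eq_bot hG₁, hη₂.isSemisimple_lefschetzLieRat_iff_center_eq_bot hG₂]
  exact h.center_lefschetzLieRat_eq_bot_iff hη₁ hη₂ hG₁ hG₂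

end Table

section TypeFour

variable {κ₁ κ₂ : Type} [Fintype κ₁] [Fintype κ₂] [DecidableEq κ₁] [DecidableEq κ₂] [Nonempty κ₁] [Nonempty κ₂]
  {E₁ E₂ : Type} [NormedAddCommGroup E₁] [NormedSpace ℂ E₁] [NormedAddCommGroup E₂] [NormedSpace ℂ E₂]
  {Ψ₁ : (κ₁ → ℝ) ≃L[ℝ] E₁} {Ψ₂ : (κ₂ → ℝ) ≃L[ℝ] E₂} {η₁ : E₁ [⋀^Fin 2]→L[ℝ] ℝ} {η₂ : E₂ [⋀^Fin 2]→L[ℝ] ℝ}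
  {G₁ : Matrix κ₁ κ₁ ℚ} {G₂ : Matrix κ₂ κ₂ ℚ}

/-- **ROW IV IS AN ISOGENY INVARIANT**: for isogenous simple polarised tori, `(End_ℚ(X₁), ′)` is of Albert type IV iff `(End_ℚ(X₂), ′)` is
(type IV ⟺ CM centre, tree `IsSimple.isAlbertTypeIV_rosatiEnd`; the centre's kind is invariant by §1).
[cite: Lange2023AbelianVarietiesComplex, §2.4.4 Cor. 2.4.26, §2.6.1 Proposition (line 4), §2.6.2 Lemma 2.6.6] [cite: Milne1999LefschetzClasses, §2 Summary table p. 652 (row IV)] -/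
theorem IsIsogenous.isAlbertTypeIV_iff (h : IsIsogenous Ψ₁ Ψ₂) (hX₁ : IsSimple Ψ₁) (hX₂ : IsSimple Ψ₂) (hη₁ : IsRiemannForm Ψ₁ η₁)
    (hη₂ : IsRiemannForm Ψ₂ η₂) (hG₁ : G₁.map (Rat.cast : ℚ → ℝ) = latticeGram Ψ₁ η₁) (hG₂ : G₂.map (Rat.cast : ℚ → ℝ) = latticeGram Ψ₂ η₂) :
    IsAlbertTypeIV (centerField Ψ₁ hX₁) (endAlgRat Ψ₁) (rosatiEnd Ψ₁ hη₁.1 hη₁.2.2 hG₁) ↔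
      IsAlbertTypeIV (centerField Ψ₂ hX₂) (endAlgRat Ψ₂) (rosatiEnd Ψ₂ hη₂.1 hη₂.2.2 hG₂) := by
  have hCM := h.isCMField_centerField_iff hX₁ hX₂ hη₁ hη₂
  constructor
  · intro h₁
    haveI := hCM.1 h₁.isCMField
    exact hX₂.isAlbertTypeIV_rosatiEnd hη₂ hG₂
  · intro h₂
    haveI := hCM.2 h₂.isCMField
    exact hX₁.isAlbertTypeIV_rosatiEnd hη₁ hG₁

variable [FiniteDimensional ℂ E₁] [FiniteDimensional ℂ E₂]

omit [Nonempty κ₁] in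
/-- `Lie S(X₁)` is semisimple iff the centre of `End_ℚ(X₂)` is totally real, for `X₁ ∼ X₂` with `X₂` simple — the «Semisimple» column of
✔ g60-#1 read through the isogeny. [cite: Milne1999LefschetzClasses, §1 Prop. 1.5 and §2 Summary table p. 652 (column «Semisimple»)] -/
theorem IsIsogenous.isSemisimple_lefschetzLieRat_iff_isTotallyReal (h : IsIsogenous Ψ₁ Ψ₂) (hX₂ : IsSimple Ψ₂)
    (hη₁ : IsRiemannForm Ψ₁ η₁) (hη₂ : IsRiemannForm Ψ₂ η₂) (hG₁ : G₁.map (Rat.cast : ℚ → ℝ) = latticeGram Ψ₁ η₁)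
    (hG₂ : G₂.map (Rat.cast : ℚ → ℝ) = latticeGram Ψ₂ η₂) :
    LieAlgebra.IsSemisimple ℚ ↥(lefschetzLieRat Ψ₁ G₁) ↔ IsTotallyReal (centerField Ψ₂ hX₂) := by
  rw [h.isSemisimple_lefschetzLieRat_iff hη₁ hη₂ hG₁ hG₂]
  exact hX₂.isSemisimple_lefschetzLieRat_iff_isTotallyReal hη₂ hG₂

end TypeFour

end ComplexTorus

end Literature.Geometry.Kaehler

end
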